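import Summits.CriticalPhenomena.PercolationContinuityZ3.Theses.PercNearOneGluing
import Literature.Probability.Percolation.PercolationEvents
import HarnessLib.Audit
import Summits.CriticalPhenomena.PercolationContinuityZ3.Theorems.PercNearOneGluingAdditiveGluingKnLemma3Mixed
import Summits.CriticalPhenomena.PercolationContinuityZ3.Theorems.PercNearOneGluingAdditiveGluingKnLemma2
import Summits.CriticalPhenomena.PercolationContinuityZ3.Theorems.PercNearOneGluingAdditiveGluingOneBond
import Literature.Probability.LatticeModels.ProdBernoulliIndependence
import Literature.Probability.LatticeModels.ProdBernoulliCoupling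

/-! TTRL-lite variant V2385 of stmt-CriticalPhenomena-4574

`stub_shorteningStep` (Kozma–Nitzan Conjecture 6 with the induction hypothesis displayed) specialised
to `n := 5`.  PROVED, and the induction hypothesis is not used.

Proof.  Write `μ₀ = prodBernoulli w`, `μ₁ = prodBernoulli (w[s(v,x) ↦ 1])`, `E = {v ↔ A}`,
`F = {a₀ ↔ b}`, `G = {v ↔ b}`.
* Harris under `μ₁`: `μ₁(E) μ₁(F) ≤ μ₁(E ∩ F)`.
* `μ₁` is the image of `μ₀` under `ω ↦ insert s(v,x) ω` (`goodStepEI_prodBernoulli_map_insert`), so it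
  remains to compare the `μ₀`-measures of the pull-backs `L` of `E ∩ F` and `R` of `G`, i.e. to show
  `μ₀(L ∖ R) ≤ μ₀(R ∖ L)`.
* A configuration of `L ∖ R` has (in `ω`, before gluing) `a₀ ↔ b`, `a₀ ↮ v`, `a₀ ↮ x`, and some relay
  `a ∈ A` joined to `v` or to `x`; that relay is NOT `a₀, b, v`.  Whenever ONE relay `a₂` with
  `μ₀(a₀ ↔ b) ≤ μ₀(a₂ ↔ b)` can be taken for all such configurations (`v2385_core`, any `n`), Kozma–Nitzan's
  Lemma 3 (mixed form `knLemma3Mixed`, from BHK 2006 Thm 1.5, proved in the tree) with the event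
  `Q = {a₂ ↔ {v,x}} ∩ {a₀ ↮ v} ∩ {a₀ ↮ x}` (increasing in `C_{a₂}`, decreasing in `C_{a₀}`) gives
  `μ₀(L ∖ R) ≤ μ₀({a₀ ↔ b} ∩ Q) ≤ μ₀({a₂ ↔ b} ∩ Q) ≤ μ₀(R ∖ L)`.
* On `Fin 5`: if `x ∈ A` take `a₂ = x`; if `a₀ = b` a null-set argument applies (`v2385_case_self`);
  otherwise the escaping relay avoids the four distinct vertices `v, x, a₀, b`, hence is the unique fifth
  vertex (pigeonhole), and `a₂` is that vertex (or there is no such relay and the bad set is empty).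
-/

namespace Summit.CriticalPhenomena.PercolationContinuityZ3.Theorems

open MeasureTheory Set Literature.Probability.LatticeModels Literature.Probability.Percolation
open scoped Classical BigOperators

section V2385

variable {n : ℕ}

/-- Reachability after opening the pair `s(v, x)`: an open path in `insert s(v,x) ω` either avoids the
new pair or passes through it once in one of the two directions. [folklore] -/
theorem v2385_reach_insert {ω : BondConfig (Fin n)} {v x y z : Fin n}
    (h : (openGraph (insert s(v, x) ω)).Reachable y z) :
    (openGraph ω).Reachable y z ∨
      ((openGraph ω).Reachable y v ∧ (openGraph ω).Reachable x z) ∨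
      ((openGraph ω).Reachable y x ∧ (openGraph ω).Reachable v z) := by
  rw [SimpleGraph.reachable_iff_reflTransGen] at h
  induction h with
  | refl => exact Or.inl (SimpleGraph.Reachable.refl _)
  | @tail b c _ hbc ih =>
    have hbc' := (openGraph_adj _ b c).1 hbc
    rcases Set.mem_insert_iff.1 hbc'.1 with heq | hmem
    · rcases Sym2.eq_iff.1 heq with ⟨hb, hc⟩ | ⟨hb, hc⟩
      · -- `b = v`, `c = x`
        subst hb; subst hc
        rcases ih with h1 | ⟨h2, -⟩ | ⟨h4, -⟩
        · exact Or.inr (Or.inl ⟨h1, SimpleGraph.Reachable.refl _⟩)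
        · exact Or.inr (Or.inl ⟨h2, SimpleGraph.Reachable.refl _⟩)
        · exact Or.inl h4
      · -- `b = x`, `c = v`
        subst hb; subst hc
        rcases ih with h1 | ⟨h2, -⟩ | ⟨h4, -⟩
        · exact Or.inr (Or.inr ⟨h1, SimpleGraph.Reachable.refl _⟩)
        · exact Or.inl h2
        · exact Or.inr (Or.inr ⟨h4, SimpleGraph.Reachable.refl _⟩)
    · have hr : (openGraph ω).Reachable b c :=
        SimpleGraph.Adj.reachable ((openGraph_adj ω b c).2 ⟨hmem, hbc'.2⟩)
      rcases ih with h1 | ⟨h2, h3⟩ | ⟨h4, h5⟩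
      · exact Or.inl (h1.trans hr)
      · exact Or.inr (Or.inl ⟨h2, h3.trans hr⟩)
      · exact Or.inr (Or.inr ⟨h4, h5.trans hr⟩)

/-- Opening a pair preserves open paths. [folklore] -/
theorem v2385_reach_mono {ω : BondConfig (Fin n)} (e : Sym2 (Fin n)) {y z : Fin n}
    (h : (openGraph ω).Reachable y z) : (openGraph (insert e ω)).Reachable y z :=
  h.mono (openGraph_mono (Set.subset_insert e ω))

/-- After opening `s(v, x)` (`v ≠ x`), `v ↔ x`. [folklore] -/
theorem v2385_reach_vx (ω : BondConfig (Fin n)) {v x : Fin n} (hvx : v ≠ x) :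
    (openGraph (insert s(v, x) ω)).Reachable v x :=
  SimpleGraph.Adj.reachable ((openGraph_adj _ v x).2 ⟨Set.mem_insert _ _, hvx⟩)

/-- `{s ↔ t}` is increasing in the open edge cluster `C_s`. [folklore] -/
theorem v2385_reach_of_cluster_subset {ω ω' : BondConfig (Fin n)} {s t : Fin n}
    (h : (openGraph ω).Reachable s t) (hsub : openEdgeCluster ω s ⊆ openEdgeCluster ω' s) :
    (openGraph ω').Reachable s t :=
  reachable_openGraph_of_fromEdgeSet ω' (openEdgeCluster_subset ω' s)
    (reachable_fromEdgeSet_of_openEdgeCluster_subset ω hsub h)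

/-- **Core of the shortening step (any `n`).**  If one relay `a₂` with `P_w(a₀ ↔ b) ≤ P_w(a₂ ↔ b)` is
joined (before gluing) to `v` or to `x` in every configuration in which some relay of `A` is joined to
`v` or `x`, `a₀ ↔ b`, and neither `v` nor `x` is joined to `b`, then Conjecture 1's inequality holds at
the glued source `v` of `w[s(v,x) ↦ 1]` against `a₀`.  Harris, pull-back along `insert s(v,x)`, and one
application of Kozma–Nitzan Lemma 3 (mixed form). [cite: KozmaNitzan2024, §5.3 Conjecture 6 and Lemma 3] -/
theorem v2385_core (w : Sym2 (Fin n) → unitInterval) (A : Finset (Fin n)) (b v x a₀ a₂ : Fin n)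
    (hvx : v ≠ x)
    (hmin₂ : (prodBernoulli w).real (openConn a₀ b) ≤ (prodBernoulli w).real (openConn a₂ b))
    (hwit : ∀ (ω : BondConfig (Fin n)) (a : Fin n), a ∈ A →
      ((openGraph ω).Reachable v a ∨ (openGraph ω).Reachable x a) →
      (openGraph ω).Reachable a₀ b → ¬ (openGraph ω).Reachable v b →
      ¬ (openGraph ω).Reachable x b →
      ((openGraph ω).Reachable a₂ v ∨ (openGraph ω).Reachable a₂ x)) :
    (prodBernoulli (Function.update w s(v, x) 1)).real (⋃ a ∈ A, openConn v a) *
        (prodBernoulli (Function.update w s(v, x) 1)).real (openConn a₀ b) ≤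
      (prodBernoulli (Function.update w s(v, x) 1)).real (openConn v b) := by
  set E : Set (BondConfig (Fin n)) := ⋃ a ∈ A, openConn v a with hE
  -- Harris under the glued measure
  have hUE : IsUpperSet E := by
    intro ω ω' hle hω
    simp only [hE, mem_iUnion, exists_prop] at hω ⊢
    obtain ⟨a, ha, h⟩ := hω
    exact ⟨a, ha, isUpperSet_openConn v a hle h⟩
  have hharris := prodBernoulli_harris (Function.update w s(v, x) 1) hUE
    (isUpperSet_openConn a₀ b) MeasurableSet.of_discrete MeasurableSet.of_discrete
  refine hharris.trans ?_
  -- pull back to `prodBernoulli w` along `insert s(v,x)`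
  have hmi : Measurable fun ω : Set (Sym2 (Fin n)) => insert s(v, x) ω := by
    refine measurable_set_iff.2 fun i => ?_
    simp only [Set.mem_insert_iff]
    exact measurable_const.or (measurable_set_mem i)
  have hpull : ∀ S : Set (BondConfig (Fin n)),
      (prodBernoulli (Function.update w s(v, x) 1)).real S =
        (prodBernoulli w).real ((fun ω : Set (Sym2 (Fin n)) => insert s(v, x) ω) ⁻¹' S) := by
    intro S
    rw [← map_measureReal_apply hmi MeasurableSet.of_discrete, goodStepEI_prodBernoulli_map_insert]
  rw [hpull (E ∩ openConn a₀ b), hpull (openConn v b)]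
  set L : Set (BondConfig (Fin n)) :=
    (fun ω : Set (Sym2 (Fin n)) => insert s(v, x) ω) ⁻¹' (E ∩ openConn a₀ b) with hL
  set R : Set (BondConfig (Fin n)) :=
    (fun ω : Set (Sym2 (Fin n)) => insert s(v, x) ω) ⁻¹' (openConn v b) with hR
  -- the conditioning event of Lemma 3: increasing in `C_{a₂}`, decreasing in `C_{a₀}`
  set Q : Set (BondConfig (Fin n)) :=
    {ω | ((openGraph ω).Reachable a₂ v ∨ (openGraph ω).Reachable a₂ x) ∧
      ¬ (openGraph ω).Reachable a₀ v ∧ ¬ (openGraph ω).Reachable a₀ x} with hQ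
  have hQmono : ∀ ω ω' : BondConfig (Fin n), ω ∈ Q →
      openEdgeCluster ω a₂ ⊆ openEdgeCluster ω' a₂ →
      openEdgeCluster ω' a₀ ⊆ openEdgeCluster ω a₀ → ω' ∈ Q := by
    rintro ω ω' ⟨h1, h2, h3⟩ h2sub h0sub
    refine ⟨?_, fun h => h2 (v2385_reach_of_cluster_subset h h0sub),
      fun h => h3 (v2385_reach_of_cluster_subset h h0sub)⟩
    rcases h1 with h1 | h1
    · exact Or.inl (v2385_reach_of_cluster_subset h1 h2sub)
    · exact Or.inr (v2385_reach_of_cluster_subset h1 h2sub)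
  have hL3 := knLemma3Mixed n w a₀ a₂ b Q 0 hQmono le_rfl (by rw [add_zero]; exact hmin₂)
  rw [add_zero] at hL3
  -- `L \ R ⊆ {a₀ ↔ b} ∩ Q`
  have hsub1 : L \ R ⊆ openConn a₀ b ∩ Q := by
    rintro ω ⟨hωL, hωR⟩
    have hωE : insert s(v, x) ω ∈ E := hωL.1
    have hab : (openGraph (insert s(v, x) ω)).Reachable a₀ b := hωL.2
    have hωR' : ¬ (openGraph (insert s(v, x) ω)).Reachable v b := hωR
    simp only [hE, mem_iUnion, exists_prop] at hωE
    obtain ⟨a, ha, hva⟩ := hωE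
    have hva : (openGraph (insert s(v, x) ω)).Reachable v a := hva
    have hvb : ¬ (openGraph ω).Reachable v b := fun h => hωR' (v2385_reach_mono _ h)
    have hxb : ¬ (openGraph ω).Reachable x b := fun h =>
      hωR' ((v2385_reach_vx ω hvx).trans (v2385_reach_mono _ h))
    have hab' : (openGraph ω).Reachable a₀ b := by
      rcases v2385_reach_insert hab with h | ⟨-, h⟩ | ⟨-, h⟩
      · exact h
      · exact absurd h hxb
      · exact absurd h hvb
    have ha₀v : ¬ (openGraph ω).Reachable a₀ v := fun h => hvb (h.symm.trans hab')
    have ha₀x : ¬ (openGraph ω).Reachable a₀ x := fun h => hxb (h.symm.trans hab')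
    have hva' : (openGraph ω).Reachable v a ∨ (openGraph ω).Reachable x a := by
      rcases v2385_reach_insert hva with h | ⟨-, h⟩ | ⟨-, h⟩
      · exact Or.inl h
      · exact Or.inr h
      · exact Or.inl h
    exact ⟨hab', hwit ω a ha hva' hab' hvb hxb, ha₀v, ha₀x⟩
  -- `{a₂ ↔ b} ∩ Q ⊆ R \ L`
  have hsub2 : openConn a₂ b ∩ Q ⊆ R \ L := by
    rintro ω ⟨ha₂b, h1, ha₀v, ha₀x⟩
    have ha₂b : (openGraph ω).Reachable a₂ b := ha₂b
    refine ⟨?_, ?_⟩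
    · show (openGraph (insert s(v, x) ω)).Reachable v b
      rcases h1 with h | h
      · exact v2385_reach_mono _ (h.symm.trans ha₂b)
      · exact (v2385_reach_vx ω hvx).trans (v2385_reach_mono _ (h.symm.trans ha₂b))
    · intro hωL
      have hab : (openGraph (insert s(v, x) ω)).Reachable a₀ b := hωL.2
      rcases v2385_reach_insert hab with h | ⟨h, -⟩ | ⟨h, -⟩
      · rcases h1 with h' | h'
        · exact ha₀v (h.trans (ha₂b.symm.trans h'))
        · exact ha₀x (h.trans (ha₂b.symm.trans h'))
      · exact ha₀v h
      · exact ha₀x h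
  have hm1 : (prodBernoulli w).real (L \ R) ≤ (prodBernoulli w).real (R \ L) :=
    calc (prodBernoulli w).real (L \ R)
        ≤ (prodBernoulli w).real (openConn a₀ b ∩ Q) := measureReal_mono hsub1
      _ ≤ (prodBernoulli w).real (openConn a₂ b ∩ Q) := hL3
      _ ≤ (prodBernoulli w).real (R \ L) := measureReal_mono hsub2
  have hsL := measureReal_inter_add_sdiff (μ := prodBernoulli w) (s := L) (t := R)
    MeasurableSet.of_discrete
  have hsR := measureReal_inter_add_sdiff (μ := prodBernoulli w) (s := R) (t := L)
    MeasurableSet.of_discrete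
  rw [Set.inter_comm] at hsR
  linarith

/-- The degenerate case `a₀ = b` of the shortening step (any `n`): the minimiser hypothesis forces
`P_w(a ↔ a₀) = 1` for every relay `a`, hence `{v ↔ A} ⊆ {v ↔ a₀}` up to a null set of the glued
measure. [cite: KozmaNitzan2024, §5.3 Conjecture 6] -/
theorem v2385_case_self (w : Sym2 (Fin n) → unitInterval) (A : Finset (Fin n)) (v x a₀ : Fin n)
    (hmin : ∀ a ∈ A, (prodBernoulli w).real (openConn a₀ a₀) ≤
      (prodBernoulli w).real (openConn a a₀)) :
    (prodBernoulli (Function.update w s(v, x) 1)).real (⋃ a ∈ A, openConn v a) *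
        (prodBernoulli (Function.update w s(v, x) 1)).real (openConn a₀ a₀) ≤
      (prodBernoulli (Function.update w s(v, x) 1)).real (openConn v a₀) := by
  set μ₁ := prodBernoulli (Function.update w s(v, x) 1) with hμ₁
  have huniv : ∀ c : Fin n, (openConn c c : Set (BondConfig (Fin n))) = Set.univ := fun c =>
    Set.eq_univ_of_forall fun ω => (SimpleGraph.Reachable.refl c : (openGraph ω).Reachable c c)
  have hle : w ≤ Function.update w s(v, x) 1 := by
    intro e
    by_cases he : e = s(v, x)
    · subst he
      rw [Function.update_self]
      exact le_top
    · rw [Function.update_of_ne he]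
  have h1 : ∀ a ∈ A, μ₁.real (openConn a a₀) = 1 := by
    intro a ha
    have hmono := prodBernoulli_real_mono_of_isUpperSet hle (isUpperSet_openConn a a₀)
      (MeasurableSet.of_discrete)
    have hw1 : (prodBernoulli w).real (openConn a a₀) = 1 := by
      apply le_antisymm measureReal_le_one
      have h := hmin a ha
      rwa [huniv, probReal_univ] at h
    rw [hw1] at hmono
    exact le_antisymm measureReal_le_one hmono
  have hEle : μ₁.real (⋃ a ∈ A, openConn v a) ≤ μ₁.real (openConn v a₀) := by
    have hsub : (⋃ a ∈ A, openConn v a : Set (BondConfig (Fin n))) ⊆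
        openConn v a₀ ∪ ⋃ a ∈ A, (openConn a a₀)ᶜ := by
      intro ω hω
      simp only [mem_iUnion, exists_prop] at hω
      obtain ⟨a, ha, h⟩ := hω
      by_cases h' : ω ∈ openConn a a₀
      · exact Or.inl (show (openGraph ω).Reachable v a₀ from
          (h : (openGraph ω).Reachable v a).trans h')
      · exact Or.inr (Set.mem_iUnion₂.2 ⟨a, ha, h'⟩)
    have hzero : ∀ a ∈ A, μ₁.real (openConn a a₀)ᶜ = 0 := by
      intro a ha
      rw [measureReal_compl MeasurableSet.of_discrete, h1 a ha, probReal_univ, sub_self]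
    calc μ₁.real (⋃ a ∈ A, openConn v a)
        ≤ μ₁.real (openConn v a₀ ∪ ⋃ a ∈ A, (openConn a a₀)ᶜ) := measureReal_mono hsub
      _ ≤ μ₁.real (openConn v a₀) + μ₁.real (⋃ a ∈ A, (openConn a a₀)ᶜ) :=
          measureReal_union_le _ _
      _ ≤ μ₁.real (openConn v a₀) + ∑ a ∈ A, μ₁.real (openConn a a₀)ᶜ := by
          gcongr
          exact measureReal_biUnion_finset_le _ _
      _ = μ₁.real (openConn v a₀) := by rw [Finset.sum_eq_zero hzero, add_zero]
  calc μ₁.real (⋃ a ∈ A, openConn v a) * μ₁.real (openConn a₀ a₀)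
      ≤ μ₁.real (⋃ a ∈ A, openConn v a) * 1 :=
        mul_le_mul_of_nonneg_left measureReal_le_one measureReal_nonneg
    _ ≤ μ₁.real (openConn v a₀) := by rw [mul_one]; exact hEle

/-- Pigeonhole in `Fin 5`: two elements avoiding four distinct elements coincide. [folklore] -/
theorem v2385_pigeonhole (v x a₀ b a u : Fin 5)
    (hvx : v ≠ x) (hva₀ : v ≠ a₀) (hvb : v ≠ b) (hxa₀ : x ≠ a₀) (hxb : x ≠ b) (ha₀b : a₀ ≠ b)
    (hav : a ≠ v) (hax : a ≠ x) (haa₀ : a ≠ a₀) (hab : a ≠ b)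
    (huv : u ≠ v) (hux : u ≠ x) (hua₀ : u ≠ a₀) (hub : u ≠ b) : a = u := by
  by_contra hau
  have h1 : v ∉ ({x, a₀, b, a, u} : Finset (Fin 5)) := by
    simp only [Finset.mem_insert, Finset.mem_singleton, not_or]
    exact ⟨hvx, hva₀, hvb, hav.symm, huv.symm⟩
  have h2 : x ∉ ({a₀, b, a, u} : Finset (Fin 5)) := by
    simp only [Finset.mem_insert, Finset.mem_singleton, not_or]
    exact ⟨hxa₀, hxb, hax.symm, hux.symm⟩
  have h3 : a₀ ∉ ({b, a, u} : Finset (Fin 5)) := by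
    simp only [Finset.mem_insert, Finset.mem_singleton, not_or]
    exact ⟨ha₀b, haa₀.symm, hua₀.symm⟩
  have h4 : b ∉ ({a, u} : Finset (Fin 5)) := by
    simp only [Finset.mem_insert, Finset.mem_singleton, not_or]
    exact ⟨hab.symm, hub.symm⟩
  have hc : ({v, x, a₀, b, a, u} : Finset (Fin 5)).card = 6 := by
    rw [Finset.card_insert_of_notMem h1, Finset.card_insert_of_notMem h2,
      Finset.card_insert_of_notMem h3, Finset.card_insert_of_notMem h4, Finset.card_pair hau]
  have h5 := Finset.card_le_univ ({v, x, a₀, b, a, u} : Finset (Fin 5))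
  rw [hc, Fintype.card_fin] at h5
  omega

/-- **TTRL-lite variant V2385 of `stub_shorteningStep` (stmt-CriticalPhenomena-4574): Kozma–Nitzan
Conjecture 6 (the shortening step, with the induction hypothesis displayed) on five vertices.**
The induction hypothesis is not used. [cite: KozmaNitzan2024, §5.3 Conjecture 6 (p. 34)] -/
theorem stub_shorteningStep_var2385 : ∀ (w : Sym2 (Fin 5) → unitInterval) (A : Finset (Fin 5)) (b v x a₀ : Fin 5), v ∉ A → v ≠ x → w s(v, x) = 0 → a₀ ∈ A → (∀ a ∈ A, (prodBernoulli w).real (openConn a₀ b) ≤ (prodBernoulli w).real (openConn a b)) → (∀ w' : Sym2 (Fin 5) → unitInterval, (∀ e, w e = 0 → w' e = 0) → ∀ (A' : Finset (Fin 5)) (o' b' : Fin 5) (t : ℝ), (∀ a ∈ A', t ≤ (prodBernoulli w').real (openConn a b')) → (prodBernoulli w').real (⋃ a ∈ A', openConn o' a) * t ≤ (prodBernoulli w').real (openConn o' b')) → (prodBernoulli (Function.update w s(v, x) 1)).real (⋃ a ∈ A, openConn v a) * (prodBernoulli (Function.update w s(v, x) 1)).real (openConn a₀ b) ≤ (prodBernoulli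 (Function.update w s(v, x) 1)).real (openConn v b) := by
  intro w A b v x a₀ hvA hvx _hw0 ha₀ hmin _hIH
  by_cases hxA : x ∈ A
  · exact v2385_core w A b v x a₀ x hvx (hmin x hxA)
      (fun ω a _ _ _ _ _ => Or.inr (SimpleGraph.Reachable.refl x))
  by_cases hab : a₀ = b
  · subst hab
    exact v2385_case_self w A v x a₀ hmin
  -- an escaping relay avoids `v, x, a₀, b`, and then `b ∉ {v, x}`
  have hout : ∀ (ω : BondConfig (Fin 5)) (a : Fin 5), a ∈ A →
      ((openGraph ω).Reachable v a ∨ (openGraph ω).Reachable x a) →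
      (openGraph ω).Reachable a₀ b → ¬ (openGraph ω).Reachable v b →
      ¬ (openGraph ω).Reachable x b →
      a ≠ v ∧ a ≠ x ∧ a ≠ a₀ ∧ a ≠ b ∧ b ≠ v ∧ b ≠ x := by
    intro ω a ha hva hab' hvb hxb
    refine ⟨fun h => hvA (h ▸ ha), fun h => hxA (h ▸ ha), ?_, ?_, ?_, ?_⟩
    · rintro rfl
      rcases hva with h | h
      · exact hvb (h.trans hab')
      · exact hxb (h.trans hab')
    · rintro rfl
      rcases hva with h | h
      · exact hvb h
      · exact hxb h
    · rintro rfl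
      exact hvb (SimpleGraph.Reachable.refl _)
    · rintro rfl
      exact hxb (SimpleGraph.Reachable.refl _)
  by_cases hu : ∃ u ∈ A, u ≠ x ∧ u ≠ a₀ ∧ u ≠ b
  · obtain ⟨u, huA, hux, hua₀, hub⟩ := hu
    have huv : u ≠ v := fun h => hvA (h ▸ huA)
    refine v2385_core w A b v x a₀ u hvx (hmin u huA) ?_
    intro ω a ha hva hab' hvb hxb
    obtain ⟨hav, hax, haa₀, habne, hbv, hbx⟩ := hout ω a ha hva hab' hvb hxb
    have hva₀ : v ≠ a₀ := fun h => hvA (h ▸ ha₀)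
    have hxa₀ : x ≠ a₀ := fun h => hxA (h ▸ ha₀)
    have hau : a = u := v2385_pigeonhole v x a₀ b a u hvx hva₀ hbv.symm hxa₀ hbx.symm hab
      hav hax haa₀ habne huv hux hua₀ hub
    subst hau
    rcases hva with h | h
    · exact Or.inl h.symm
    · exact Or.inr h.symm
  · push Not at hu
    refine v2385_core w A b v x a₀ a₀ hvx le_rfl ?_
    intro ω a ha hva hab' hvb hxb
    obtain ⟨-, hax, haa₀, habne, -, -⟩ := hout ω a ha hva hab' hvb hxb
    exact absurd (hu a ha hax haa₀) habne

end V2385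

end Summit.CriticalPhenomena.PercolationContinuityZ3.Theorems
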